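import Literature.MathematicalPhysics.KineticTheory.PseudoTrajectoryCoupling
import Literature.MathematicalPhysics.KineticTheory.CollisionTermComparison
import HarnessLib

/-!
# The one-step comparison of the BBGKY and Boltzmann collision operators on coupled pairs
# (BGSR Props. 5.6–5.7: the hypothesis `RelStep` for the hard-sphere/Boltzmann coupling)
(Bodineau–Gallagher–Saint-Raymond, Invent. Math. 203 (2016) = arXiv:1305.3397v2, §5.3.3
"Neglecting the pathological pseudo-trajectories", Propositions 5.6 and 5.7 and their proofs,
(5.22), pp. 20–21 of the held text; trunk T-KINETIC, topic MathematicalPhysics/KineticTheory;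
the CONCRETE one-step comparison of the bottom-up plan towards the named fact
`bgsr_linearBoltzmannApprox` (`TaggedSphereDiffusion`) recorded in `TaggedSphereLinearBoltzmannRate`:
it discharges the hypothesis `HierarchyModel.Coupling.RelStep` of the abstract comparison
`HierarchyComparison` for the coupling `PseudoTrajectoryCoupling` of the hard-sphere model
`hsHierarchyModel` with the Boltzmann model on `T^d`, from BGSR Prop. 5.1
(`GoodConfigurations(Measure)`), Prop. 5.3 (`PseudoTrajectoryCoupling`) and the one-label
estimate `CollisionTermComparison`.)

BGSR Proposition 5.6 (p. 20) bounds the contribution of the pathological pseudo-trajectories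
(one adjoined particle chosen in the bad set `ℬ^{m_k}_k` of Prop. 5.1) to both main terms by
`A^{(K+2)(K+1)} (Cαt)^{A^{K+1}} × (5.22) × ‖ρ⁰‖_∞`: *"removing the integration over the
pathological set `ℬ_k^{m_k}` gives an error `C k (E^d (ā/ε₀)^{d-1} + E^d (Et)^d ε₀^{d-1} +
E (ε₀/δ)^{d-1})` according to Proposition 5.1. For a given `J`, there are `J_K - 1 ≤ A^{K+1}`
possible choices of the integral to be modified"*; Proposition 5.7 (p. 21) compares the
remaining, coupled integrals: *"The prefactors in the collision operators: … prefactors of the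
type `(N-k)ε^{d-1}/α` that can be replaced in the limit by `1`. For fixed `J_K`, the corresponding
error is `(1 - (N-1)⋯(N-J_K+1)/N^{J_K+1}) ≤ C J_K²/N` … Discrepancy between `f_N^{0(J_K)}(Z_{J_K}(0))`
and `g^{0(J_K)}(Z^0_{J_K}(0))`"* (the latter is the discrepancy of the DATA, propagated by the
relational chain estimate of `HierarchyComparison`; it does not enter the one-step comparison).

This file PROVES, for the coupling `bgsrCouplingUpTo` (the coupled pairs `bgsrCoupledPairs` of
`PseudoTrajectoryCoupling` with horizons capped by the horizon `t` of the bad sets):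

* `hsCollisionTerm_eq_zero_of_lt`, `outBbgkyOp_eq_zero_of_lt'`, `boltzmannHOp_eq_zero_of_lt` —
  the collision operators of both models kill, above an energy, densities vanishing above that
  energy (the hypotheses `hV` of `HierarchyComparison`: adjoining a particle does not decrease the
  kinetic energy);
* `relStep_bgsrCouplingUpTo` — **the one-step comparison** `Coupling.RelStep` with
  `Λ_rel = α C_d λₘ^{-d/2} (k_max λₘ^{-1/2} + (k_max/η)^{1/2})` (the chain cost of the Boltzmann
  model) and `E_rel = p_f C_d λₘ^{-d/2}(…) + 4 α k_max E m_bad` — `p_f` a bound on the prefactor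
  discrepancies `|(N-k)ε^{d-1} - α|`, `k ≤ k_max` (Prop. 5.7, first bullet), `m_bad` a bound on the
  `σ ⊗ dv`-measure of the bad sets of Prop. 5.1 restricted to `B_E` (Prop. 5.6, (5.22);
  `sphereMeasure_prod_bgsrBadSet_le`). Mechanism: at a coupled level-`k` pair transported by an
  a.e. time `s` (off the null set where the pseudo-trajectory is irregular, `bgsrRegular`, and
  off `s = σ`), either the energy exceeds `E²/2` and both operators vanish, or label by label
  the two elementary terms are compared by `abs_hsCollisionTerm_sub_hsCollisionTerm_le`, the
  coupled parameters being those outside `bgsrBadSet t ā ε₀ δ (3E)`, for which Prop. 5.3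
  (`mem_bgsrCoupledPairs_gainConfig/_lossConfig`) makes the relational hypothesis available; the
  velocity moments are absorbed by the weight decrement `η` as in Lemma 4.2.

## References

* T. Bodineau, I. Gallagher, L. Saint-Raymond, *The Brownian motion as the limit of a
  deterministic system of hard-spheres*, Invent. Math. 203 (2016) 493–553 = arXiv:1305.3397v2,
  §5.3.3 Props. 5.6–5.7, (5.22), pp. 20–21.
-/

open MeasureTheory Metric Real Set Filter Function
open scoped InnerProductSpace ENNReal
open Literature.Analysis.FluidPDE (Config configEnergy Geometry gainConfig lossConfig
  hsCollisionTerm bbgkyCollisionOp boltzmannHOp boltzmannHierarchyOp hardSphereDomain freeFlight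
  configEnergy_gainConfig configEnergy_lossConfig bgsrGoodConfigs)

namespace Literature.MathematicalPhysics.KineticTheory

noncomputable section

open Literature.Analysis.FunctionSpaces Literature.Analysis.FunctionSpaces.Torus
open Literature.Analysis.FluidPDE.Torus

section Kinetic

variable {d : Type*} [Fintype d]

/-! ## §1. The collision operators kill densities vanishing above an energy -/

section Support

variable {X : Type*} [MeasurableSpace X] {k : ℕ}

omit [MeasurableSpace X] in
/-- An elementary collision term of a density vanishing above the energy `E_c`, read at a
configuration of energy `> E_c`, vanishes: the gain and loss configurations have energy
`H(Z_k) + |v|²/2 ≥ H(Z_k) > E_c`. [folklore] -/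
theorem hsCollisionTerm_eq_zero_of_lt (G : Geometry d X) (ε : ℝ) (i : Fin k) {Ec : ℝ}
    {g : Config (k + 1) d X → ℝ} (hg : ∀ W, Ec < configEnergy W → g W = 0) {Z : Config k d X}
    (hZ : Ec < configEnergy Z) : hsCollisionTerm G ε k i g Z = 0 := by
  unfold Literature.Analysis.FluidPDE.hsCollisionTerm
  refine integral_eq_zero_of_ae (Eventually.of_forall fun ω => ?_)
  refine integral_eq_zero_of_ae (Eventually.of_forall fun v => ?_)
  have hv : 0 ≤ 2⁻¹ * ‖v‖ ^ 2 := by positivity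
  have h1 : g (gainConfig G ε Z i ω v) = 0 := hg _ (by rw [configEnergy_gainConfig]; linarith)
  have h2 : g (lossConfig G ε Z i ω v) = 0 := hg _ (by rw [configEnergy_lossConfig]; linarith)
  simp [h1, h2]

omit [MeasurableSpace X] in
/-- The outgoing BBGKY collision operator kills, above `E_c`, densities vanishing above `E_c`
(the hypothesis `hV` of `HierarchyComparison` for `hsHierarchyModel`). [folklore] -/
theorem outBbgkyOp_eq_zero_of_lt' (G : Geometry d X) (ε : ℝ) (N : ℕ) {Ec : ℝ}
    {g : Config (k + 1) d X → ℝ} (hg : ∀ W, Ec < configEnergy W → g W = 0) {Z : Config k d X}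
    (hZ : Ec < configEnergy Z) : outBbgkyOp G ε N k g Z = 0 := by
  unfold outBbgkyOp Literature.Analysis.FluidPDE.bbgkyCollisionOp
  refine Finset.sum_eq_zero fun i _ => ?_
  rw [hsCollisionTerm_eq_zero_of_lt G ε i (g := g ∘ outRep G k i) (fun W hW => ?_) hZ, mul_zero]
  exact hg _ (by rwa [configEnergy_outRep])

omit [MeasurableSpace X] in
/-- The Boltzmann hierarchy collision operator kills, above `E_c`, densities vanishing above
`E_c` (the hypothesis `hV` of `HierarchyComparison` for `boltzmannModel`). [folklore] -/
theorem boltzmannHOp_eq_zero_of_lt (G : Geometry d X) {Ec : ℝ} {g : Config (k + 1) d X → ℝ}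
    (hg : ∀ W, Ec < configEnergy W → g W = 0) {Z : Config k d X} (hZ : Ec < configEnergy Z) :
    boltzmannHOp G k g Z = 0 := by
  unfold Literature.Analysis.FluidPDE.boltzmannHOp Literature.Analysis.FluidPDE.boltzmannHierarchyOp
  exact Finset.sum_eq_zero fun i _ => hsCollisionTerm_eq_zero_of_lt G 0 i hg hZ

omit [MeasurableSpace X] in
/-- Configurations with the same velocities have the same kinetic energy. [folklore] -/
theorem configEnergy_eq_of_vel_eq {Z Y : Config k d X} (h : ∀ i, (Z i).2 = (Y i).2) :
    configEnergy Z = configEnergy Y := by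
  unfold Literature.Analysis.FluidPDE.configEnergy
  simp_rw [h]

/-- `abs_hsCollisionTerm_sub_hsCollisionTerm_le` with the coupling hypothesis stated almost
everywhere (the null set of irregular parameters left implicit). [cite: BodineauGallagherSaintRaymondInvent2016, §5.3.3 Props. 5.6-5.7, pp. 20–21] -/
theorem abs_hsCollisionTerm_sub_hsCollisionTerm_le_of_ae {G : Geometry d X}
    (hG : Measurable fun p : X × EuclideanSpace ℝ d => G.translate p.1 p.2) (ε₁ ε₂ : ℝ) (i : Fin k)
    {g₁ g₂ : Config (k + 1) d X → ℝ} (hg₁m : Measurable g₁) (hg₂m : Measurable g₂)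
    {K b ηr E m : ℝ} (hb : 0 < b) (hK : 0 ≤ K) (hηr : 0 ≤ ηr) (hE : 0 ≤ E) (hm : 0 ≤ m)
    (hg₁ : ∀ W, |g₁ W| ≤ K * exp (-b * configEnergy W))
    (hg₂ : ∀ W, |g₂ W| ≤ K * exp (-b * configEnergy W))
    {Zs Ys : Config k d X} (hvi : (Zs i).2 = (Ys i).2) (hH : configEnergy Zs = configEnergy Ys)
    (hviE : ‖(Ys i).2‖ ≤ E) {T : Set (sphere (0 : EuclideanSpace ℝ d) 1 × EuclideanSpace ℝ d)}
    (hT : MeasurableSet T)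
    (hTm : ((sphereMeasure (E := EuclideanSpace ℝ d)).prod (volume : Measure (EuclideanSpace ℝ d))) T ≤
      ENNReal.ofReal m)
    (hsupp : ∀ (ω : sphere (0 : EuclideanSpace ℝ d) 1) (v : EuclideanSpace ℝ d), E < ‖v‖ →
      g₁ (gainConfig G ε₁ Zs i ω v) = 0 ∧ g₁ (lossConfig G ε₁ Zs i ω v) = 0 ∧
      g₂ (gainConfig G ε₂ Ys i ω v) = 0 ∧ g₂ (lossConfig G ε₂ Ys i ω v) = 0)
    (hcpl : ∀ᵐ q : sphere (0 : EuclideanSpace ℝ d) 1 × EuclideanSpace ℝ d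
        ∂((sphereMeasure (E := EuclideanSpace ℝ d)).prod (volume : Measure (EuclideanSpace ℝ d))),
      q ∉ T → ‖q.2‖ ≤ E →
      (0 < ⟪(q.1 : EuclideanSpace ℝ d), q.2 - (Ys i).2⟫_ℝ →
        |g₁ (gainConfig G ε₁ Zs i q.1 q.2) - g₂ (gainConfig G ε₂ Ys i q.1 q.2)| ≤
          ηr * exp (-b * (configEnergy Ys + 2⁻¹ * ‖q.2‖ ^ 2))) ∧
      (⟪(q.1 : EuclideanSpace ℝ d), q.2 - (Ys i).2⟫_ℝ < 0 →
        |g₁ (lossConfig G ε₁ Zs i q.1 q.2) - g₂ (lossConfig G ε₂ Ys i q.1 q.2)| ≤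
          ηr * exp (-b * (configEnergy Ys + 2⁻¹ * ‖q.2‖ ^ 2)))) :
    |hsCollisionTerm G ε₁ k i g₁ Zs - hsCollisionTerm G ε₂ k i g₂ Ys| ≤
      (((∫ u : EuclideanSpace ℝ d, (1 + ‖u‖) * exp (-(1 / 2) * ‖u‖ ^ 2)) *
            (sphereMeasure (E := EuclideanSpace ℝ d)).real univ) *
          (sqrt b ^ Fintype.card d)⁻¹ * ((sqrt b)⁻¹ + ‖(Ys i).2‖) * ηr + 4 * E * m * K) *
        exp (-b * configEnergy Ys) :=
  abs_hsCollisionTerm_sub_hsCollisionTerm_le hG ε₁ ε₂ i hg₁m hg₂m hb hK hηr hE hm hg₁ hg₂ hvi hH hviE hT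
    hTm (ae_iff.1 hcpl) hsupp fun _ _ hT' hN hv => (not_not.1 hN) hT' hv

end Support

/-! ## §2. The coupling with capped horizons -/

section Capped

/-- **The coupling of the hard-sphere and Boltzmann models with horizons capped by `t`**: the
coupled pairs `bgsrCoupledPairs ε ε₀ δ k σ` of `PseudoTrajectoryCoupling` for `σ ≤ t` and `k ≥ 1`,
nothing for `σ > t` (the bad sets of BGSR Prop. 5.1 control the free flights over the horizon `t`
of Theorem 2.2 only; the main terms are compared at the top pair of horizon `Kh ≤ t`) or for
`k = 0` (no particle: this level never enters the expansions of a one-particle density, and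
excluding it spares the comparison of the total masses of the data).
[cite: BodineauGallagherSaintRaymondInvent2016, §5.2.2 Prop. 5.3, p. 18] -/
def bgsrCouplingUpTo {ε : ℝ} (hε : 0 < ε) (hε' : ε < 2⁻¹) (N : ℕ) (α ε₀ : ℝ) {δ : ℝ}
    (hδ : 0 ≤ δ) (t : ℝ) :
    (hsHierarchyModel (d := d) hε hε' N).Coupling
      (boltzmannModel (Literature.Analysis.FluidPDE.Torus.geometry d) measurable_translate_torus α) δ where
  rel := fun k σ => {p | σ ≤ t ∧ 0 < k ∧ p ∈ bgsrCoupledPairs ε ε₀ δ k σ}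
  trans := fun _ _ _ hp s hs =>
    ⟨by linarith [hp.1, hs.1, hδ], hp.2.1, bgsrCoupledPairs_transport hε hε' hδ hp.2.2 hs⟩

/-- The relation of `bgsrCouplingUpTo`. [folklore] -/
@[simp]
theorem mem_bgsrCouplingUpTo_rel {ε : ℝ} (hε : 0 < ε) (hε' : ε < 2⁻¹) (N : ℕ) (α ε₀ : ℝ) {δ : ℝ}
    (hδ : 0 ≤ δ) (t : ℝ) (k : ℕ) (σ : ℝ)
    (p : Config k d (UnitAddTorus d) × Config k d (UnitAddTorus d)) :
    p ∈ (bgsrCouplingUpTo (d := d) hε hε' N α ε₀ hδ t).rel k σ ↔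
      σ ≤ t ∧ 0 < k ∧ p ∈ bgsrCoupledPairs ε ε₀ δ k σ :=
  Iff.rfl

end Capped

/-! ## §3. The one-step comparison -/

section RelStep

variable [DecidableEq d]

omit [DecidableEq d] in
/-- Absorption of the velocity moments by the weight decrement (as in the proof of Lemma 4.2):
`(k λ^{-1/2} + ∑ |v_i|) e^{-(λ₀+η)H} ≤ (k_max λₘ^{-1/2} + (k_max/η)^{1/2}) e^{-λ₀ H}` for
`λ = λ₀ + η ≥ λₘ`, `k ≤ k_max`. [cite: BodineauGallagherSaintRaymondInvent2016, §4.2 Lemma 4.2 proof, p. 12] -/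
theorem moment_mul_exp_le {X : Type*} {k kmax : ℕ} (hk : k ≤ kmax) {bm b₀ η : ℝ} (hbm : 0 < bm)
    (hb₀ : bm ≤ b₀) (hη : 0 < η) (Y : Config k d X) :
    (k * (sqrt (b₀ + η))⁻¹ + ∑ i, ‖(Y i).2‖) * exp (-(b₀ + η) * configEnergy Y) ≤
      (kmax * (sqrt bm)⁻¹ + sqrt (kmax / η)) * exp (-b₀ * configEnergy Y) := by
  have hE := configEnergy_nonneg' Y
  have hexp : exp (-(b₀ + η) * configEnergy Y) = exp (-η * configEnergy Y) * exp (-b₀ * configEnergy Y) := by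
    rw [← Real.exp_add]; ring_nf
  have h1 := sum_norm_mul_exp_neg_mul_configEnergy_le Y hη
  have hk' : (k : ℝ) ≤ kmax := by exact_mod_cast hk
  have h2 : sqrt (k / η) ≤ sqrt (kmax / η) := sqrt_le_sqrt (by gcongr)
  have hsb : 0 < sqrt bm := sqrt_pos.2 hbm
  have h3 : (k : ℝ) * (sqrt (b₀ + η))⁻¹ ≤ kmax * (sqrt bm)⁻¹ :=
    mul_le_mul hk' (inv_anti₀ hsb (sqrt_le_sqrt (by linarith))) (inv_nonneg.2 (sqrt_nonneg _))
      (Nat.cast_nonneg _)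
  have h4 : exp (-η * configEnergy Y) ≤ 1 := exp_le_one_iff.2 (by nlinarith)
  have h5 : (k : ℝ) * (sqrt (b₀ + η))⁻¹ * exp (-η * configEnergy Y) ≤ kmax * (sqrt bm)⁻¹ := by
    calc (k : ℝ) * (sqrt (b₀ + η))⁻¹ * exp (-η * configEnergy Y) ≤ kmax * (sqrt bm)⁻¹ * 1 :=
          mul_le_mul h3 h4 (exp_pos _).le (by positivity)
      _ = _ := mul_one _
  calc (k * (sqrt (b₀ + η))⁻¹ + ∑ i, ‖(Y i).2‖) * exp (-(b₀ + η) * configEnergy Y)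
      = ((k : ℝ) * (sqrt (b₀ + η))⁻¹ * exp (-η * configEnergy Y) +
          (∑ i, ‖(Y i).2‖) * exp (-η * configEnergy Y)) * exp (-b₀ * configEnergy Y) := by
        rw [hexp]; ring
    _ ≤ (kmax * (sqrt bm)⁻¹ + sqrt (kmax / η)) * exp (-b₀ * configEnergy Y) :=
        mul_le_mul_of_nonneg_right (add_le_add h5 (h1.trans h2)) (exp_pos _).le

/-- **The one-step comparison of the BBGKY and Boltzmann collision operators on coupled pairs**
(BGSR Props. 5.6–5.7, one collision operator: the hypothesis `Coupling.RelStep` of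
`HierarchyComparison` for `bgsrCouplingUpTo`). Setting: `N` hard spheres of diameter `ε` on `T^d`
(`0 < ε < 1/2`) against the Boltzmann hierarchy with rate `α ≥ 0`; bad-set parameters
`t, ā, ε₀, δ` of Prop. 5.1 with `(k_max + 1) ε ≤ ā`, `4ā ≤ ε₀`, `δ > 0`, energy cut-off `E ≥ 0`;
`p_f` bounds the prefactor discrepancies `|(N-k)ε^{d-1} - α|`, `k ≤ k_max` (Prop. 5.7: "prefactors
… that can be replaced in the limit by `1`"), `m_bad` bounds the `σ ⊗ dv`-measure of the bad sets
`bgsrBadSet t ā ε₀ δ (3E) Y m ∩ {|v| ≤ E}` at good `Y` (Prop. 5.6, (5.22)). Then for the weight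
floor `λₘ` and decrement `η`, `RelStep (E²/2) λₘ η k_max Λ_rel E_rel` holds with
`Λ_rel = α C_d λₘ^{-d/2}(k_max λₘ^{-1/2} + (k_max/η)^{1/2})`,
`E_rel = p_f C_d λₘ^{-d/2}(…) + 4 α k_max E m_bad`, `C_d = (∫(1+|u|)e^{-|u|²/2}du) |S^{d-1}|`.
Proof: at a coupled pair transported by an a.e. time `s` (regular, `s ≠ σ`), if the energy
exceeds `E²/2` both operators vanish; otherwise each label is compared by
`abs_hsCollisionTerm_sub_hsCollisionTerm_le` — the coupled parameters are those outside the bad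
set (and the null irregular set), where Prop. 5.3 (`mem_bgsrCoupledPairs_gainConfig/_lossConfig`)
supplies a coupled level-`(k+1)` pair on which the relational hypothesis is read — plus the
prefactor discrepancy times the continuity estimate of the BBGKY term; summing over the labels and
absorbing the velocity moments by `η` gives the claim.
[cite: BodineauGallagherSaintRaymondInvent2016, §5.3.3 Props. 5.6-5.7, pp. 20–21] -/
theorem relStep_bgsrCouplingUpTo {ε : ℝ} (hε : 0 < ε) (hε' : ε < 2⁻¹) (N : ℕ) {α ε₀ δ t ā E : ℝ}
    (hα : 0 ≤ α) (hδ : 0 < δ) (hE : 0 ≤ E) (hāε₀ : 4 * ā ≤ ε₀) {kmax : ℕ}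
    (hkε : (kmax + 1 : ℝ) * ε ≤ ā) {pf : ℝ}
    (hpf : ∀ k ≤ kmax, |((N - k : ℕ) : ℝ) * ε ^ (Fintype.card d - 1) - α| ≤ pf) {mBad : ℝ}
    (hmBad0 : 0 ≤ mBad)
    (hmBad : ∀ k ≤ kmax, ∀ (Y : Config k d (UnitAddTorus d)) (m : Fin k) (σ' : ℝ), 0 ≤ σ' →
      Y ∈ bgsrGoodConfigs (Literature.Analysis.FluidPDE.Torus.geometry d) k ε₀ σ' →
      ((sphereMeasure (E := EuclideanSpace ℝ d)).prod (volume : Measure (EuclideanSpace ℝ d)))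
          {q : sphere (0 : EuclideanSpace ℝ d) 1 × EuclideanSpace ℝ d |
            ‖q.2‖ ≤ E ∧ ((q.1 : EuclideanSpace ℝ d), q.2) ∈ bgsrBadSet t ā ε₀ δ (3 * E) Y m} ≤
        ENNReal.ofReal mBad)
    {bm η : ℝ} (hbm : 0 < bm) (hη : 0 < η) :
    (bgsrCouplingUpTo (d := d) hε hε' N α ε₀ hδ.le t).RelStep (E ^ 2 / 2) bm η kmax
      (α * ((∫ u : EuclideanSpace ℝ d, (1 + ‖u‖) * exp (-(1 / 2) * ‖u‖ ^ 2)) *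
          (sphereMeasure (E := EuclideanSpace ℝ d)).real univ) *
        ((sqrt bm ^ Fintype.card d)⁻¹ * (kmax * (sqrt bm)⁻¹ + sqrt (kmax / η))))
      (pf * ((∫ u : EuclideanSpace ℝ d, (1 + ‖u‖) * exp (-(1 / 2) * ‖u‖ ^ 2)) *
          (sphereMeasure (E := EuclideanSpace ℝ d)).real univ) *
        ((sqrt bm ^ Fintype.card d)⁻¹ * (kmax * (sqrt bm)⁻¹ + sqrt (kmax / η))) +
        4 * α * kmax * E * mBad) := by
  haveI := Literature.Analysis.FluidPDE.isFiniteMeasure_sphereMeasure (E := EuclideanSpace ℝ d)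
  set Cd : ℝ := (∫ u : EuclideanSpace ℝ d, (1 + ‖u‖) * exp (-(1 / 2) * ‖u‖ ^ 2)) *
    (sphereMeasure (E := EuclideanSpace ℝ d)).real univ with hCd
  set Sh : ℝ := (sqrt bm ^ Fintype.card d)⁻¹ * (kmax * (sqrt bm)⁻¹ + sqrt (kmax / η)) with hSh
  have hCd0 : 0 ≤ Cd := mul_nonneg (integral_nonneg fun u => by positivity) measureReal_nonneg
  have hsbm : 0 < sqrt bm := sqrt_pos.2 hbm
  have hSh0 : 0 ≤ Sh := by positivity
  have hpf0 : 0 ≤ pf := (abs_nonneg _).trans (hpf 0 (Nat.zero_le _))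
  intro k hk σ p hp
  rw [mem_bgsrCouplingUpTo_rel] at hp
  obtain ⟨hσt, -, hZgood, hreg, hready⟩ := hp
  have hR := ae_of_forall_bgsrRegular hreg
  have hne : ∀ᵐ s : ℝ, s ≠ σ := by
    rw [ae_iff]
    simp only [not_not, setOf_eq_eq_singleton, measure_singleton]
  filter_upwards [hR, hne] with s hRs hsσ
  intro hsI g₁ g₂ K ηr b₀ hb₀ hK hηr hg₁m hg₂m hg₁ hg₂ hgv₁ hgv₂ hrel
  rw [hsHierarchyModel_flow, hsHierarchyModel_op, boltzmannModel_flow, boltzmannModel_op]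
  set Zs := Literature.Analysis.FluidPDE.Alexander.regFlow (Literature.Analysis.FluidPDE.Torus.geometry d) ε (-s) p.1
    with hZs
  set Ys := freeFlight (Literature.Analysis.FluidPDE.Torus.geometry d) (-s) p.2 with hYs
  have hs0 : s ∈ Icc 0 σ := ⟨hδ.le.trans hsI.1, hsI.2⟩
  have hσ'0 : 0 < σ - s := sub_pos.2 (lt_of_le_of_ne hsI.2 hsσ)
  have hσ't : σ - s ≤ t := by linarith [hs0.1]
  obtain ⟨hvel, hpos, hx0, hYgood, hZsgood⟩ := hready s hsI
  have hHeq : configEnergy Zs = configEnergy Ys := configEnergy_eq_of_vel_eq hvel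
  have hb : 0 < b₀ + η := by linarith
  have hexp0 : 0 ≤ exp (-b₀ * configEnergy Ys) := (exp_pos _).le
  have hRHS0 : 0 ≤ (α * Cd * Sh * ηr + (pf * Cd * Sh + 4 * α * kmax * E * mBad) * K) *
      exp (-b₀ * configEnergy Ys) := by positivity
  by_cases hHE : E ^ 2 / 2 < configEnergy Ys
  · -- above the energy cut-off both operators vanish
    have h1 : outBbgkyOp (Literature.Analysis.FluidPDE.Torus.geometry d) ε N k g₁ Zs = 0 :=
      outBbgkyOp_eq_zero_of_lt' _ ε N hgv₁ (by rw [hHeq]; exact hHE)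
    have h2 : boltzmannHOp (Literature.Analysis.FluidPDE.Torus.geometry d) k g₂ Ys = 0 :=
      boltzmannHOp_eq_zero_of_lt _ hgv₂ hHE
    rw [h1, h2, mul_zero, sub_zero, abs_zero]
    exact hRHS0
  rw [not_lt] at hHE
  have hspeed : ∀ j, ‖(Ys j).2‖ ≤ E := norm_vel_le_of_configEnergy_le hE hHE
  have hk' : (k : ℝ) ≤ kmax := by exact_mod_cast hk
  have hk0 : (0 : ℝ) ≤ k := Nat.cast_nonneg k
  have hkε' : (k + 1 : ℝ) * ε ≤ ā :=
    le_trans (mul_le_mul_of_nonneg_right (by linarith) hε.le) hkε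
  have hkk : (k : ℝ) * ε ≤ (k + 1) * ε := mul_le_mul_of_nonneg_right (by linarith) hε.le
  have hā : ∀ j, euclidDist (Zs j).1 (Ys j).1 ≤ ā := fun j => (hpos j).trans (hkk.trans hkε')
  have hεā : ε ≤ ā := le_trans (le_mul_of_one_le_left hε.le (by linarith)) hkε'
  have hāε₀' : 4 * ā ≤ ε₀ := hāε₀
  have hready' : (Zs, Ys) ∈ bgsrReadyPairs ε ε₀ k (σ - s) := ⟨hvel, hpos, hx0, hYgood, hZsgood⟩
  have hRsi := hRs hs0
  -- the common factors of the label-by-label bound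
  set eb : ℝ := exp (-(b₀ + η) * configEnergy Ys) with heb
  set P : ℝ := (pf * K + α * ηr) * Cd * (sqrt (b₀ + η) ^ Fintype.card d)⁻¹ * eb with hP
  set Q : ℝ := α * (4 * E * mBad * K) * eb with hQ
  -- label by label
  have hlab : ∀ i : Fin k,
      |((N - k : ℕ) : ℝ) * ε ^ (Fintype.card d - 1) *
          hsCollisionTerm (Literature.Analysis.FluidPDE.Torus.geometry d) ε k i
            (g₁ ∘ outRep (Literature.Analysis.FluidPDE.Torus.geometry d) k i) Zs -
        α * hsCollisionTerm (Literature.Analysis.FluidPDE.Torus.geometry d) 0 k i g₂ Ys| ≤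
        P * ((sqrt (b₀ + η))⁻¹ + ‖(Ys i).2‖) + Q := by
    intro i
    set c : ℝ := ((N - k : ℕ) : ℝ) * ε ^ (Fintype.card d - 1) with hc
    have hg₁' : ∀ W, |(g₁ ∘ outRep (Literature.Analysis.FluidPDE.Torus.geometry d) k i) W| ≤
        K * exp (-(b₀ + η) * configEnergy W) := fun W => abs_comp_outRep_le i hg₁ W
    have hg₁'m : Measurable (g₁ ∘ outRep (Literature.Analysis.FluidPDE.Torus.geometry d) k i) :=
      hg₁m.comp (measurable_outRep Literature.Analysis.FluidPDE.Torus.isMeasurable_geometry k i)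
    -- continuity estimate of the BBGKY term
    have hA := abs_hsCollisionTerm_le_weighted (Literature.Analysis.FluidPDE.Torus.geometry d) ε i hb
      hg₁' Zs
    rw [hvel i, hHeq] at hA
    -- the bad superset
    set B : Set (sphere (0 : EuclideanSpace ℝ d) 1 × EuclideanSpace ℝ d) :=
      {q | ‖q.2‖ ≤ E ∧ ((q.1 : EuclideanSpace ℝ d), q.2) ∈ bgsrBadSet t ā ε₀ δ (3 * E) Ys i} with hB
    have hT : MeasurableSet (toMeasurable ((sphereMeasure (E := EuclideanSpace ℝ d)).prod
        (volume : Measure (EuclideanSpace ℝ d))) B) := measurableSet_toMeasurable _ B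
    have hTm : ((sphereMeasure (E := EuclideanSpace ℝ d)).prod (volume : Measure (EuclideanSpace ℝ d)))
        (toMeasurable ((sphereMeasure (E := EuclideanSpace ℝ d)).prod
          (volume : Measure (EuclideanSpace ℝ d))) B) ≤ ENNReal.ofReal mBad := by
      rw [measure_toMeasurable]
      exact hmBad k hk Ys i (σ - s) hσ'0.le hYgood
    -- large velocities: both densities vanish on the collision configurations
    have hsupp : ∀ (ω : sphere (0 : EuclideanSpace ℝ d) 1) (v : EuclideanSpace ℝ d), E < ‖v‖ →
        (g₁ ∘ outRep (Literature.Analysis.FluidPDE.Torus.geometry d) k i)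
            (gainConfig (Literature.Analysis.FluidPDE.Torus.geometry d) ε Zs i ω v) = 0 ∧
          (g₁ ∘ outRep (Literature.Analysis.FluidPDE.Torus.geometry d) k i)
            (lossConfig (Literature.Analysis.FluidPDE.Torus.geometry d) ε Zs i ω v) = 0 ∧
          g₂ (gainConfig (Literature.Analysis.FluidPDE.Torus.geometry d) 0 Ys i ω v) = 0 ∧
          g₂ (lossConfig (Literature.Analysis.FluidPDE.Torus.geometry d) 0 Ys i ω v) = 0 := by
      intro ω v hvE
      have hv2 : E ^ 2 / 2 < 2⁻¹ * ‖v‖ ^ 2 := by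
        rw [div_eq_inv_mul]
        exact mul_lt_mul_of_pos_left (pow_lt_pow_left₀ hvE hE two_ne_zero) (by norm_num)
      have hZ0 : E ^ 2 / 2 < configEnergy Zs + 2⁻¹ * ‖v‖ ^ 2 :=
        lt_of_lt_of_le hv2 (le_add_of_nonneg_left (configEnergy_nonneg' Zs))
      have hY0 : E ^ 2 / 2 < configEnergy Ys + 2⁻¹ * ‖v‖ ^ 2 :=
        lt_of_lt_of_le hv2 (le_add_of_nonneg_left (configEnergy_nonneg' Ys))
      refine ⟨hgv₁ _ ?_, hgv₁ _ ?_, hgv₂ _ ?_, hgv₂ _ ?_⟩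
      · rw [configEnergy_outRep, configEnergy_gainConfig]; exact hZ0
      · rw [configEnergy_outRep, configEnergy_lossConfig]; exact hZ0
      · rw [configEnergy_gainConfig]; exact hY0
      · rw [configEnergy_lossConfig]; exact hY0
    -- the coupled parameters: off the bad set and the irregular null set, Prop. 5.3 applies
    have hcpl : ∀ᵐ q : sphere (0 : EuclideanSpace ℝ d) 1 × EuclideanSpace ℝ d
        ∂((sphereMeasure (E := EuclideanSpace ℝ d)).prod (volume : Measure (EuclideanSpace ℝ d))),
        q ∉ toMeasurable ((sphereMeasure (E := EuclideanSpace ℝ d)).prod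
          (volume : Measure (EuclideanSpace ℝ d))) B → ‖q.2‖ ≤ E →
        (0 < ⟪(q.1 : EuclideanSpace ℝ d), q.2 - (Ys i).2⟫_ℝ →
          |(g₁ ∘ outRep (Literature.Analysis.FluidPDE.Torus.geometry d) k i)
              (gainConfig (Literature.Analysis.FluidPDE.Torus.geometry d) ε Zs i q.1 q.2) -
            g₂ (gainConfig (Literature.Analysis.FluidPDE.Torus.geometry d) 0 Ys i q.1 q.2)| ≤
            ηr * exp (-(b₀ + η) * (configEnergy Ys + 2⁻¹ * ‖q.2‖ ^ 2))) ∧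
        (⟪(q.1 : EuclideanSpace ℝ d), q.2 - (Ys i).2⟫_ℝ < 0 →
          |(g₁ ∘ outRep (Literature.Analysis.FluidPDE.Torus.geometry d) k i)
              (lossConfig (Literature.Analysis.FluidPDE.Torus.geometry d) ε Zs i q.1 q.2) -
            g₂ (lossConfig (Literature.Analysis.FluidPDE.Torus.geometry d) 0 Ys i q.1 q.2)| ≤
            ηr * exp (-(b₀ + η) * (configEnergy Ys + 2⁻¹ * ‖q.2‖ ^ 2))) := by
      filter_upwards [hRsi i] with q hRq
      intro hqT hvE
      obtain ⟨ω, v⟩ := q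
      have hbad : ((ω : EuclideanSpace ℝ d), v) ∉ bgsrBadSet t ā ε₀ δ (3 * E) Ys i := fun hb' =>
        hqT (subset_toMeasurable _ B ⟨hvE, hb'⟩)
      obtain ⟨hpre, hpost⟩ := not_mem_bgsrBadSet_iff.1 hbad
      have hω : ‖(ω : EuclideanSpace ℝ d)‖ = 1 := norm_eq_of_mem_sphere ω
      constructor
      · intro hsign
        have hsign' : 0 < ⟪(ω : EuclideanSpace ℝ d), v - (Zs i).2⟫_ℝ := by rwa [hvel i]
        have hfl : ∀ u ∈ Ioc 0 (σ - s), ∀ p' q' : Fin (k + 1), p' ≠ q' →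
            ε < flightDist u (gainConfig (Literature.Analysis.FluidPDE.Torus.geometry d) ε Zs i ω v) p' q' :=
          fun u hu p' q' hpq => bgsr_prop51_post_bbgky hε hεā hāε₀' hσ't (le_refl (3 * E)) hYgood
            hvel hā hspeed hvE hω hsign hpost hu.1 hu.2 hpq
        have hdom : gainConfig (Literature.Analysis.FluidPDE.Torus.geometry d) ε Zs i ω v ∈
            hardSphereDomain (Literature.Analysis.FluidPDE.Torus.geometry d) (k + 1) ε := by
          intro p' q' hpq
          rw [Literature.Analysis.FluidPDE.Torus.norm_geometry_sepVec, ← flightDist_zero]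
          exact le_flightDist_zero_of_Ioc hσ'0 fun u hu => hfl u hu p' q' hpq
        obtain ⟨hgood, hregq⟩ := hRq.1 hsign' hdom
        have hq := mem_bgsrCoupledPairs_gainConfig hε hε' hkε' hāε₀' hδ hσ't hready' hHE hE hvE hω
          hsign hbad hgood hregq
        have h := hrel _ ((mem_bgsrCouplingUpTo_rel hε hε' N α ε₀ hδ.le t (k + 1) (σ - s) _).2
          ⟨hσ't, Nat.succ_pos k, hq⟩)
        rwa [configEnergy_gainConfig] at h
      · intro hsign
        have hsign' : ⟪(ω : EuclideanSpace ℝ d), v - (Zs i).2⟫_ℝ < 0 := by rwa [hvel i]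
        have hEW : 2 * E ≤ 3 * E := by linarith
        have hfl : ∀ u ∈ Ioc 0 (σ - s), ∀ p' q' : Fin (k + 1), p' ≠ q' →
            ε < flightDist u (lossConfig (Literature.Analysis.FluidPDE.Torus.geometry d) ε Zs i ω v) p' q' :=
          fun u hu p' q' hpq => bgsr_prop51_pre_bbgky hε hεā hāε₀' hσ't hEW hYgood hvel hā hspeed
            hvE hω hsign hpre hu.1 hu.2 hpq
        have hdom : lossConfig (Literature.Analysis.FluidPDE.Torus.geometry d) ε Zs i ω v ∈
            hardSphereDomain (Literature.Analysis.FluidPDE.Torus.geometry d) (k + 1) ε := by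
          intro p' q' hpq
          rw [Literature.Analysis.FluidPDE.Torus.norm_geometry_sepVec, ← flightDist_zero]
          exact le_flightDist_zero_of_Ioc hσ'0 fun u hu => hfl u hu p' q' hpq
        obtain ⟨hgood, hregq⟩ := hRq.2 hsign' hdom
        have hq := mem_bgsrCoupledPairs_lossConfig hε hε' hkε' hāε₀' hδ hσ't hready' hHE hE hvE hω
          hsign hbad hgood hregq
        have h := hrel _ ((mem_bgsrCouplingUpTo_rel hε hε' N α ε₀ hδ.le t (k + 1) (σ - s) _).2
          ⟨hσ't, Nat.succ_pos k, hq⟩)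
        rwa [configEnergy_lossConfig] at h
    -- the comparison of the two elementary terms
    have hB' := abs_hsCollisionTerm_sub_hsCollisionTerm_le_of_ae
      (G := Literature.Analysis.FluidPDE.Torus.geometry d) measurable_translate_torus ε 0 i hg₁'m hg₂m hb
      hK hηr hE hmBad0 hg₁' hg₂ (hvel i) hHeq (hspeed i) hT hTm hsupp hcpl
    -- combine
    have hcα : |c - α| ≤ pf := hpf k hk
    have hshb : 0 ≤ (sqrt (b₀ + η) ^ Fintype.card d)⁻¹ := by positivity
    have hvi0 : 0 ≤ (sqrt (b₀ + η))⁻¹ + ‖(Ys i).2‖ := by positivity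
    have heb0 : 0 ≤ eb := (exp_pos _).le
    have hA0 : 0 ≤ Cd * (sqrt (b₀ + η) ^ Fintype.card d)⁻¹ * ((sqrt (b₀ + η))⁻¹ + ‖(Ys i).2‖) *
        (K * eb) := by positivity
    calc |c * hsCollisionTerm (Literature.Analysis.FluidPDE.Torus.geometry d) ε k i
              (g₁ ∘ outRep (Literature.Analysis.FluidPDE.Torus.geometry d) k i) Zs -
            α * hsCollisionTerm (Literature.Analysis.FluidPDE.Torus.geometry d) 0 k i g₂ Ys|
        = |(c - α) * hsCollisionTerm (Literature.Analysis.FluidPDE.Torus.geometry d) ε k i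
              (g₁ ∘ outRep (Literature.Analysis.FluidPDE.Torus.geometry d) k i) Zs +
            α * (hsCollisionTerm (Literature.Analysis.FluidPDE.Torus.geometry d) ε k i
                (g₁ ∘ outRep (Literature.Analysis.FluidPDE.Torus.geometry d) k i) Zs -
              hsCollisionTerm (Literature.Analysis.FluidPDE.Torus.geometry d) 0 k i g₂ Ys)| := by
          congr 1; ring
      _ ≤ |c - α| * |hsCollisionTerm (Literature.Analysis.FluidPDE.Torus.geometry d) ε k i
              (g₁ ∘ outRep (Literature.Analysis.FluidPDE.Torus.geometry d) k i) Zs| +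
            α * |hsCollisionTerm (Literature.Analysis.FluidPDE.Torus.geometry d) ε k i
                (g₁ ∘ outRep (Literature.Analysis.FluidPDE.Torus.geometry d) k i) Zs -
              hsCollisionTerm (Literature.Analysis.FluidPDE.Torus.geometry d) 0 k i g₂ Ys| := by
          refine (abs_add_le _ _).trans (le_of_eq ?_)
          rw [abs_mul, abs_mul, abs_of_nonneg hα]
      _ ≤ pf * (Cd * (sqrt (b₀ + η) ^ Fintype.card d)⁻¹ * ((sqrt (b₀ + η))⁻¹ + ‖(Ys i).2‖) * (K * eb)) +
            α * ((Cd * (sqrt (b₀ + η) ^ Fintype.card d)⁻¹ * ((sqrt (b₀ + η))⁻¹ + ‖(Ys i).2‖) * ηr +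
              4 * E * mBad * K) * eb) :=
          add_le_add (mul_le_mul hcα hA (abs_nonneg _) hpf0) (mul_le_mul_of_nonneg_left hB' hα)
      _ = P * ((sqrt (b₀ + η))⁻¹ + ‖(Ys i).2‖) + Q := by rw [hP, hQ]; ring
  -- sum over the labels
  have hsum : |outBbgkyOp (Literature.Analysis.FluidPDE.Torus.geometry d) ε N k g₁ Zs -
      α * boltzmannHOp (Literature.Analysis.FluidPDE.Torus.geometry d) k g₂ Ys| ≤
      P * (k * (sqrt (b₀ + η))⁻¹ + ∑ i, ‖(Ys i).2‖) + k * Q := by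
    unfold outBbgkyOp Literature.Analysis.FluidPDE.bbgkyCollisionOp
      Literature.Analysis.FluidPDE.boltzmannHOp Literature.Analysis.FluidPDE.boltzmannHierarchyOp
    rw [Finset.mul_sum, ← Finset.sum_sub_distrib]
    refine (Finset.abs_sum_le_sum_abs _ _).trans ?_
    refine (Finset.sum_le_sum fun i _ => hlab i).trans (le_of_eq ?_)
    rw [Finset.sum_add_distrib, ← Finset.mul_sum, Finset.sum_add_distrib, Finset.sum_const,
      Finset.sum_const, Finset.card_univ, Fintype.card_fin, nsmul_eq_mul, nsmul_eq_mul]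
  refine hsum.trans ?_
  -- absorb the moments and the level
  have hmom := moment_mul_exp_le (X := UnitAddTorus d) hk hbm hb₀ hη Ys
  have hshb : (sqrt (b₀ + η) ^ Fintype.card d)⁻¹ ≤ (sqrt bm ^ Fintype.card d)⁻¹ :=
    inv_anti₀ (pow_pos hsbm _) (pow_le_pow_left₀ hsbm.le (sqrt_le_sqrt (by linarith)) _)
  have heb1 : eb ≤ exp (-b₀ * configEnergy Ys) := by
    rw [heb]
    refine exp_le_exp.2 ?_
    rw [neg_add, add_mul]
    linarith [mul_nonneg hη.le (configEnergy_nonneg' Ys)]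
  have hPK : 0 ≤ (pf * K + α * ηr) * Cd := by positivity
  have h1 : P * (k * (sqrt (b₀ + η))⁻¹ + ∑ i, ‖(Ys i).2‖) ≤
      (pf * K + α * ηr) * Cd * (sqrt bm ^ Fintype.card d)⁻¹ *
        ((kmax * (sqrt bm)⁻¹ + sqrt (kmax / η)) * exp (-b₀ * configEnergy Ys)) := by
    rw [hP]
    calc (pf * K + α * ηr) * Cd * (sqrt (b₀ + η) ^ Fintype.card d)⁻¹ * eb *
          (k * (sqrt (b₀ + η))⁻¹ + ∑ i, ‖(Ys i).2‖)
        = (pf * K + α * ηr) * Cd * (sqrt (b₀ + η) ^ Fintype.card d)⁻¹ *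
            ((k * (sqrt (b₀ + η))⁻¹ + ∑ i, ‖(Ys i).2‖) * eb) := by ring
      _ ≤ (pf * K + α * ηr) * Cd * (sqrt bm ^ Fintype.card d)⁻¹ *
            ((kmax * (sqrt bm)⁻¹ + sqrt (kmax / η)) * exp (-b₀ * configEnergy Ys)) := by
          apply mul_le_mul (mul_le_mul_of_nonneg_left hshb hPK) hmom (by positivity) (by positivity)
  have h2 : (k : ℝ) * Q ≤ kmax * (α * (4 * E * mBad * K) * exp (-b₀ * configEnergy Ys)) := by
    rw [hQ]
    exact mul_le_mul hk' (mul_le_mul_of_nonneg_left heb1 (by positivity)) (by positivity) (by positivity)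
  calc P * (k * (sqrt (b₀ + η))⁻¹ + ∑ i, ‖(Ys i).2‖) + k * Q
      ≤ (pf * K + α * ηr) * Cd * (sqrt bm ^ Fintype.card d)⁻¹ *
          ((kmax * (sqrt bm)⁻¹ + sqrt (kmax / η)) * exp (-b₀ * configEnergy Ys)) +
        kmax * (α * (4 * E * mBad * K) * exp (-b₀ * configEnergy Ys)) := add_le_add h1 h2
    _ = (α * Cd * Sh * ηr + (pf * Cd * Sh + 4 * α * kmax * E * mBad) * K) *
          exp (-b₀ * configEnergy Ys) := by rw [hSh]; ring

end RelStep

end Kinetic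

end

end Literature.MathematicalPhysics.KineticTheory
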